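import Mathlib
import Summits.Ventures.PercRepro2.ZMeanProof
import Summits.Ventures.PercRepro2.PendantRoot
import Summits.Ventures.PercRepro2.PocketTransport
import Summits.Ventures.PercRepro2.StarGlue
import Summits.Ventures.PercRepro2.StarOProb

/-!
# The four-coin star at `a₃` with ends `a₁, a₂, o, b` (the hub class `{a₁, a₂, o, b}`): glue and
outcomes (blind cell PercRepro2, night-1 g11; NIGHT1-G11.md §5)

`a₃` carries exactly the four edges `f₁ = {a₃, a₁}` (coin `α`), `f₂ = {a₃, a₂}` (`β`),
`f₃ = {a₃, o}` (`r`), `f₄ = {a₃, b}` (`s`).  On an outcome of the four coins the open neighbours of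
`a₃` are the marks with an open coin (`openAdj_a3_iff`); a connection among vertices other than
`a₃` is a star-closed one, or goes through `a₃`: both ends touch the open block (`conn_iff_glue₄`,
`touch`); the cluster of `a₃` is the star-closed union of the clusters of the open marks
(`conn_a3_iff₄`).  The outcome calculus (`outc₄`, `prob_inter_outc₄`, `prob_eq_sum_outc₄`,
`prob_star_of_pointwise₄`) is the four-coin copy of `StarO` / `StarOB`'s.  Every single-vertex
class of the (HMF) table is a face of this star (a closed coin is a zero-weight edge).
-/

namespace Summit.Ventures.PercRepro2

open StarGlue PendantRoot

namespace StarH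

variable {V : Type*} {E : Type*}

variable {ends : E → Sym2 V} {f₁ f₂ f₃ f₄ : E} {a₃ a₁ a₂ o b : V}

/-- A star edge at `a₃`, by `hstar`. -/
lemma star_edge (hstar : ∀ e, a₃ ∈ ends e → e = f₁ ∨ e = f₂ ∨ e = f₃ ∨ e = f₄) {e : E} {y : V}
    (h : ends e = s(a₃, y)) : e = f₁ ∨ e = f₂ ∨ e = f₃ ∨ e = f₄ :=
  hstar e (by rw [h]; exact Sym2.mem_mk_left _ _)

/-- The other end of a star edge whose ends are `s(a₃, m)`. -/
lemma end_eq_of_ends_eq {m y : V} (hy : a₃ ≠ y) (h : s(a₃, y) = s(a₃, m)) : m = y := by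
  rcases Sym2.eq_iff.1 h with ⟨_, h'⟩ | ⟨h', h''⟩
  · exact h'.symm
  · exact absurd h''.symm hy

/-- **The open neighbours of `a₃`** on the four-coin star. -/
theorem openAdj_a3_iff (hf₁ : ends f₁ = s(a₃, a₁)) (hf₂ : ends f₂ = s(a₃, a₂))
    (hf₃ : ends f₃ = s(a₃, o)) (hf₄ : ends f₄ = s(a₃, b))
    (hstar : ∀ e, a₃ ∈ ends e → e = f₁ ∨ e = f₂ ∨ e = f₃ ∨ e = f₄)
    (h31 : a₃ ≠ a₁) (h32 : a₃ ≠ a₂) (h3o : a₃ ≠ o) (h3b : a₃ ≠ b) {ω : Config E} {m : V} :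
    OpenAdj ends ω a₃ m ↔ (ω f₁ = true ∧ m = a₁) ∨ (ω f₂ = true ∧ m = a₂) ∨
      (ω f₃ = true ∧ m = o) ∨ (ω f₄ = true ∧ m = b) := by
  constructor
  · rintro ⟨e, he, hends⟩
    rcases star_edge hstar hends with rfl | rfl | rfl | rfl
    · exact Or.inl ⟨he, end_eq_of_ends_eq h31 (hf₁.symm.trans hends)⟩
    · exact Or.inr (Or.inl ⟨he, end_eq_of_ends_eq h32 (hf₂.symm.trans hends)⟩)
    · exact Or.inr (Or.inr (Or.inl ⟨he, end_eq_of_ends_eq h3o (hf₃.symm.trans hends)⟩))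
    · exact Or.inr (Or.inr (Or.inr ⟨he, end_eq_of_ends_eq h3b (hf₄.symm.trans hends)⟩))
  · rintro (⟨he, rfl⟩ | ⟨he, rfl⟩ | ⟨he, rfl⟩ | ⟨he, rfl⟩)
    · exact ⟨f₁, he, hf₁⟩
    · exact ⟨f₂, he, hf₂⟩
    · exact ⟨f₃, he, hf₃⟩
    · exact ⟨f₄, he, hf₄⟩

/-- Connectivity is symmetric (as an `iff`, for rewriting). -/
lemma conn_comm (ω : Config E) (x y : V) : Conn ends ω x y ↔ Conn ends ω y x :=
  ⟨conn_symm, conn_symm⟩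

section Glue

variable [DecidablePred (· ∈ (touches ends {a₃})ᶜ)]

variable (ends f₁ f₂ f₃ f₄ a₃ a₁ a₂ o b) in
/-- `z` touches the open block of the star (read in the star-closed configuration). -/
def touch (ω : Config E) (z : V) : Prop :=
  (ω f₁ = true ∧ Conn ends (closeStar ends a₃ ω) z a₁) ∨
    (ω f₂ = true ∧ Conn ends (closeStar ends a₃ ω) z a₂) ∨
    (ω f₃ = true ∧ Conn ends (closeStar ends a₃ ω) z o) ∨
    (ω f₄ = true ∧ Conn ends (closeStar ends a₃ ω) z b)

/-- `x` reaches an open neighbour of `a₃` iff it touches the open block. -/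
lemma exists_openAdj_iff_touch (hf₁ : ends f₁ = s(a₃, a₁)) (hf₂ : ends f₂ = s(a₃, a₂))
    (hf₃ : ends f₃ = s(a₃, o)) (hf₄ : ends f₄ = s(a₃, b))
    (hstar : ∀ e, a₃ ∈ ends e → e = f₁ ∨ e = f₂ ∨ e = f₃ ∨ e = f₄)
    (h31 : a₃ ≠ a₁) (h32 : a₃ ≠ a₂) (h3o : a₃ ≠ o) (h3b : a₃ ≠ b) {ω : Config E} {x : V} :
    (∃ m, OpenAdj ends ω a₃ m ∧ Conn ends (closeStar ends a₃ ω) x m) ↔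
      touch ends f₁ f₂ f₃ f₄ a₃ a₁ a₂ o b ω x := by
  unfold touch
  constructor
  · rintro ⟨m, hm, hxm⟩
    rw [openAdj_a3_iff hf₁ hf₂ hf₃ hf₄ hstar h31 h32 h3o h3b] at hm
    rcases hm with ⟨h, rfl⟩ | ⟨h, rfl⟩ | ⟨h, rfl⟩ | ⟨h, rfl⟩
    · exact Or.inl ⟨h, hxm⟩
    · exact Or.inr (Or.inl ⟨h, hxm⟩)
    · exact Or.inr (Or.inr (Or.inl ⟨h, hxm⟩))
    · exact Or.inr (Or.inr (Or.inr ⟨h, hxm⟩))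
  · rintro (⟨h, hx⟩ | ⟨h, hx⟩ | ⟨h, hx⟩ | ⟨h, hx⟩)
    · exact ⟨a₁, (openAdj_a3_iff hf₁ hf₂ hf₃ hf₄ hstar h31 h32 h3o h3b).2 (Or.inl ⟨h, rfl⟩), hx⟩
    · exact ⟨a₂, (openAdj_a3_iff hf₁ hf₂ hf₃ hf₄ hstar h31 h32 h3o h3b).2
        (Or.inr (Or.inl ⟨h, rfl⟩)), hx⟩
    · exact ⟨o, (openAdj_a3_iff hf₁ hf₂ hf₃ hf₄ hstar h31 h32 h3o h3b).2
        (Or.inr (Or.inr (Or.inl ⟨h, rfl⟩))), hx⟩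
    · exact ⟨b, (openAdj_a3_iff hf₁ hf₂ hf₃ hf₄ hstar h31 h32 h3o h3b).2
        (Or.inr (Or.inr (Or.inr ⟨h, rfl⟩))), hx⟩

/-- **The four-coin glue lemma**: for `x, y ≠ a₃`, `x ↔ y` iff `x ↔ y` with the star closed, or
both `x` and `y` touch the open block. -/
theorem conn_iff_glue₄ (hf₁ : ends f₁ = s(a₃, a₁)) (hf₂ : ends f₂ = s(a₃, a₂))
    (hf₃ : ends f₃ = s(a₃, o)) (hf₄ : ends f₄ = s(a₃, b))
    (hstar : ∀ e, a₃ ∈ ends e → e = f₁ ∨ e = f₂ ∨ e = f₃ ∨ e = f₄)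
    (h31 : a₃ ≠ a₁) (h32 : a₃ ≠ a₂) (h3o : a₃ ≠ o) (h3b : a₃ ≠ b) {ω : Config E} {x y : V}
    (hx : x ≠ a₃) (hy : y ≠ a₃) :
    Conn ends ω x y ↔ Conn ends (closeStar ends a₃ ω) x y ∨
      (touch ends f₁ f₂ f₃ f₄ a₃ a₁ a₂ o b ω x ∧ touch ends f₁ f₂ f₃ f₄ a₃ a₁ a₂ o b ω y) := by
  rw [conn_iff_glue hx hy, exists_openAdj_iff_touch hf₁ hf₂ hf₃ hf₄ hstar h31 h32 h3o h3b]
  have e : (∃ m', OpenAdj ends ω a₃ m' ∧ Conn ends (closeStar ends a₃ ω) m' y) ↔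
      (∃ m', OpenAdj ends ω a₃ m' ∧ Conn ends (closeStar ends a₃ ω) y m') := by
    constructor
    · rintro ⟨m, hm, h⟩; exact ⟨m, hm, conn_symm h⟩
    · rintro ⟨m, hm, h⟩; exact ⟨m, hm, conn_symm h⟩
  rw [e, exists_openAdj_iff_touch hf₁ hf₂ hf₃ hf₄ hstar h31 h32 h3o h3b]

/-- **The cluster of `a₃`**: for `y ≠ a₃`, `a₃ ↔ y` iff `y` touches the open block. -/
theorem conn_a3_iff₄ (hf₁ : ends f₁ = s(a₃, a₁)) (hf₂ : ends f₂ = s(a₃, a₂))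
    (hf₃ : ends f₃ = s(a₃, o)) (hf₄ : ends f₄ = s(a₃, b))
    (hstar : ∀ e, a₃ ∈ ends e → e = f₁ ∨ e = f₂ ∨ e = f₃ ∨ e = f₄)
    (h31 : a₃ ≠ a₁) (h32 : a₃ ≠ a₂) (h3o : a₃ ≠ o) (h3b : a₃ ≠ b) {ω : Config E} {y : V}
    (hy : y ≠ a₃) :
    Conn ends ω a₃ y ↔ touch ends f₁ f₂ f₃ f₄ a₃ a₁ a₂ o b ω y := by
  rw [conn_a3_iff_glue hy]
  have e : (∃ m', OpenAdj ends ω a₃ m' ∧ Conn ends (closeStar ends a₃ ω) m' y) ↔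
      (∃ m', OpenAdj ends ω a₃ m' ∧ Conn ends (closeStar ends a₃ ω) y m') := by
    constructor
    · rintro ⟨m, hm, h⟩; exact ⟨m, hm, conn_symm h⟩
    · rintro ⟨m, hm, h⟩; exact ⟨m, hm, conn_symm h⟩
  rw [e, exists_openAdj_iff_touch hf₁ hf₂ hf₃ hf₄ hstar h31 h32 h3o h3b]

end Glue

end StarH

namespace StarH

section Infra

variable {V : Type*} {E : Type*} [Fintype E] [DecidableEq E] [Fintype V] [DecidableEq V]
  {R : Type*} [Field R] [LinearOrder R] [IsStrictOrderedRing R]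

variable (p : E → R) (ends : E → Sym2 V) (a₃ : V)

open StarO (pOut viaStar cw prob_viaStar free_viaStar prob_inter_coin free_coin_of_ne)

/-- The coin outcome `{ω f₁ = b₁, ω f₂ = b₂, ω f₃ = b₃, ω f₄ = b₄}` of the four-coin star. -/
def outc₄ (f₁ f₂ f₃ f₄ : E) (b₁ b₂ b₃ b₄ : Bool) : Set (Config E) :=
  {ω | ω f₁ = b₁ ∧ ω f₂ = b₂ ∧ ω f₃ = b₃ ∧ ω f₄ = b₄}

omit [Fintype E] [DecidableEq E] [Fintype V] [DecidableEq V] [LinearOrder R] [IsStrictOrderedRing R] in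
/-- Membership in an outcome. -/
lemma mem_outc₄ {f₁ f₂ f₃ f₄ : E} {b₁ b₂ b₃ b₄ : Bool} {ω : Config E} :
    ω ∈ outc₄ f₁ f₂ f₃ f₄ b₁ b₂ b₃ b₄ ↔ ω f₁ = b₁ ∧ ω f₂ = b₂ ∧ ω f₃ = b₃ ∧ ω f₄ = b₄ := Iff.rfl

omit [Fintype V] [DecidableEq V] [LinearOrder R] [IsStrictOrderedRing R] in
/-- **Factorisation on an outcome**: for `A` free of the four star edges,
`P(A ∩ outc₄ b) = P(A) · cw b₁ · cw b₂ · cw b₃ · cw b₄`. -/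
lemma prob_inter_outc₄ {f₁ f₂ f₃ f₄ : E} (h12 : f₁ ≠ f₂) (h13 : f₁ ≠ f₃) (h14 : f₁ ≠ f₄)
    (h23 : f₂ ≠ f₃) (h24 : f₂ ≠ f₄) (h34 : f₃ ≠ f₄) {A : Set (Config E)} (h1 : Free f₁ A)
    (h2 : Free f₂ A) (h3 : Free f₃ A) (h4 : Free f₄ A) (b₁ b₂ b₃ b₄ : Bool) :
    prob p (A ∩ outc₄ f₁ f₂ f₃ f₄ b₁ b₂ b₃ b₄) =
      prob p A * cw b₁ (p f₁) * cw b₂ (p f₂) * cw b₃ (p f₃) * cw b₄ (p f₄) := by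
  have e : A ∩ outc₄ f₁ f₂ f₃ f₄ b₁ b₂ b₃ b₄ =
      (((A ∩ {ω | ω f₁ = b₁}) ∩ {ω | ω f₂ = b₂}) ∩ {ω | ω f₃ = b₃}) ∩ {ω | ω f₄ = b₄} := by
    ext ω; simp only [Set.mem_inter_iff, mem_outc₄, Set.mem_setOf_eq]; tauto
  rw [e, prob_inter_coin p (((h4.inter (free_coin_of_ne h14.symm b₁)).inter
      (free_coin_of_ne h24.symm b₂)).inter (free_coin_of_ne h34.symm b₃)) b₄,
    prob_inter_coin p ((h3.inter (free_coin_of_ne h13.symm b₁)).inter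
      (free_coin_of_ne h23.symm b₂)) b₃,
    prob_inter_coin p (h2.inter (free_coin_of_ne h12.symm b₁)) b₂, prob_inter_coin p h1 b₁]

omit [Fintype V] [DecidableEq V] [LinearOrder R] [IsStrictOrderedRing R] in
/-- **The outcomes partition the space.** -/
lemma prob_eq_sum_outc₄ (f₁ f₂ f₃ f₄ : E) (A : Set (Config E)) :
    prob p A = ∑ b₁ : Bool, ∑ b₂ : Bool, ∑ b₃ : Bool, ∑ b₄ : Bool,
      prob p (A ∩ outc₄ f₁ f₂ f₃ f₄ b₁ b₂ b₃ b₄) := by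
  have h1 : ∀ (B : Set (Config E)) (f : E),
      prob p B = ∑ b : Bool, prob p (B ∩ {ω | ω f = b}) := by
    intro B f
    rw [Fintype.sum_bool]
    have := prob_inter_add_prob_inter_compl p B (openEdge f)
    rw [← this]
    have hc : {ω : Config E | ω f = false} = (openEdge f)ᶜ := by
      ext ω; simp [openEdge]
    rw [hc]
    rfl
  rw [h1 A f₁]
  refine Finset.sum_congr rfl fun b₁ _ => ?_
  rw [h1 (A ∩ {ω | ω f₁ = b₁}) f₂]
  refine Finset.sum_congr rfl fun b₂ _ => ?_
  rw [h1 (A ∩ {ω | ω f₁ = b₁} ∩ {ω | ω f₂ = b₂}) f₃]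
  refine Finset.sum_congr rfl fun b₃ _ => ?_
  rw [h1 (A ∩ {ω | ω f₁ = b₁} ∩ {ω | ω f₂ = b₂} ∩ {ω | ω f₃ = b₃}) f₄]
  refine Finset.sum_congr rfl fun b₄ _ => ?_
  congr 1
  ext ω; simp only [Set.mem_inter_iff, Set.mem_setOf_eq, mem_outc₄]; tauto

omit [Fintype E] [DecidableEq E] [Fintype V] [DecidableEq V] [LinearOrder R] [IsStrictOrderedRing R] in
/-- Two star edges are distinct when their far ends differ. -/
lemma star_edges_ne {f f' : E} {x y : V} (hf : ends f = s(a₃, x)) (hf' : ends f' = s(a₃, y))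
    (hxy : x ≠ y) (h3x : a₃ ≠ x) : f ≠ f' := by
  intro h
  subst h
  rw [hf] at hf'
  exact hxy (end_eq_of_ends_eq h3x hf').symm

omit [Fintype E] [DecidableEq E] [LinearOrder R] [IsStrictOrderedRing R] in
/-- A pointwise reading on an outcome gives the set identity with any star-closed event. -/
lemma set_eq_of_pointwise {f₁ f₂ f₃ f₄ : E} {E₀ E' : Set (Config E)} {b₁ b₂ b₃ b₄ : Bool}
    (h : ∀ ω ∈ outc₄ f₁ f₂ f₃ f₄ b₁ b₂ b₃ b₄, ω ∈ E₀ ↔ closeStar ends a₃ ω ∈ E')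
    (X : Set (Config E)) :
    E₀ ∩ viaStar ends a₃ X ∩ outc₄ f₁ f₂ f₃ f₄ b₁ b₂ b₃ b₄ =
      viaStar ends a₃ (E' ∩ X) ∩ outc₄ f₁ f₂ f₃ f₄ b₁ b₂ b₃ b₄ := by
  ext ω
  simp only [Set.mem_inter_iff, viaStar, Set.mem_setOf_eq]
  constructor
  · rintro ⟨⟨hE, hX⟩, hO⟩; exact ⟨⟨(h ω hO).1 hE, hX⟩, hO⟩
  · rintro ⟨⟨hE, hX⟩, hO⟩; exact ⟨⟨(h ω hO).2 hE, hX⟩, hO⟩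

omit [LinearOrder R] [IsStrictOrderedRing R] in
/-- **The factorised form of a mass** from its pointwise readings on the sixteen outcomes. -/
theorem prob_star_of_pointwise₄ {f₁ f₂ f₃ f₄ : E} {a₁ a₂ o b : V}
    (hf₁ : ends f₁ = s(a₃, a₁)) (hf₂ : ends f₂ = s(a₃, a₂)) (hf₃ : ends f₃ = s(a₃, o))
    (hf₄ : ends f₄ = s(a₃, b)) (h12 : f₁ ≠ f₂) (h13 : f₁ ≠ f₃) (h14 : f₁ ≠ f₄) (h23 : f₂ ≠ f₃)
    (h24 : f₂ ≠ f₄) (h34 : f₃ ≠ f₄) (E₀ : Set (Config E))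
    (E' : Bool → Bool → Bool → Bool → Set (Config E))
    (h : ∀ b₁ b₂ b₃ b₄, ∀ ω ∈ outc₄ f₁ f₂ f₃ f₄ b₁ b₂ b₃ b₄,
      ω ∈ E₀ ↔ closeStar ends a₃ ω ∈ E' b₁ b₂ b₃ b₄)
    (X : Set (Config E)) :
    prob p (E₀ ∩ viaStar ends a₃ X) =
      ∑ b₁ : Bool, ∑ b₂ : Bool, ∑ b₃ : Bool, ∑ b₄ : Bool,
        prob (pOut p ends a₃) (E' b₁ b₂ b₃ b₄ ∩ X) *
          cw b₁ (p f₁) * cw b₂ (p f₂) * cw b₃ (p f₃) * cw b₄ (p f₄) := by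
  have hf1 : a₃ ∈ ends f₁ := by rw [hf₁]; exact Sym2.mem_mk_left _ _
  have hf2 : a₃ ∈ ends f₂ := by rw [hf₂]; exact Sym2.mem_mk_left _ _
  have hf3 : a₃ ∈ ends f₃ := by rw [hf₃]; exact Sym2.mem_mk_left _ _
  have hf4 : a₃ ∈ ends f₄ := by rw [hf₄]; exact Sym2.mem_mk_left _ _
  rw [prob_eq_sum_outc₄ p f₁ f₂ f₃ f₄]
  refine Finset.sum_congr rfl fun b₁ _ => Finset.sum_congr rfl fun b₂ _ =>
    Finset.sum_congr rfl fun b₃ _ => Finset.sum_congr rfl fun b₄ _ => ?_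
  rw [set_eq_of_pointwise ends a₃ (h b₁ b₂ b₃ b₄) X,
    prob_inter_outc₄ p h12 h13 h14 h23 h24 h34 (free_viaStar ends a₃ hf1 _)
      (free_viaStar ends a₃ hf2 _) (free_viaStar ends a₃ hf3 _) (free_viaStar ends a₃ hf4 _),
    prob_viaStar]

end Infra

end StarH

end Summit.Ventures.PercRepro2
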